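import Literature.Probability.RandomPlanarGeometry.HexSAWBrickWallSlabInsertion
import Literature.Probability.RandomPlanarGeometry.HexSAWHammersleyWelshExplicit
import HarnessLib

/-!
# `μ(Slab_H) < μ(Slab_{H+1}) ≤ μ_ℍ` for the column slabs of the brick wall (the armchair family), with an explicit
# margin — and SUB-CRITICALITY of every slab at `x_c`: `Σ_n c_n(Slab_H) x_c^n < ∞`

Topic `Literature/Probability/RandomPlanarGeometry` (the leaf of the door R100 «HEX-ARMCHAIR-SLAB-SUBCRIT»:
`HexSAWBrickWallSlabInsertion.lean` — the double-row insertion `HexBW.slabInsertion` on the column slabs `Slab_H = {0,…,H} × ℤ`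
with its three properties hcost/hmem/hinj — fed to `HexSAWBrickWallSlabInsertionCore.lean`).  Statement shape: N. Madras,
G. Slade, *The Self-Avoiding Walk* (1993), §8.2, Theorem 8.2.1, eq. (8.2.13) ("`μ(R[k,T]) < μ(R[k,T+1])`", ℤ^d tubes/slabs;
(8.2.11) "`μ(R) < μ`").  For the honeycomb lattice in Beaton's rotated (armchair) orientation the finiteness at `x_c` of the
generating function of walks confined to a strip is used in N. R. Beaton, *J. Phys. A* 47 (2014), proof of Corollary 10 /
Proposition 9-type arguments; here it follows from `μ(Slab_H) < μ_ℍ = 1/x_c` by an injective insertion (the lane's proof).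

## Statements (namespace `Literature.Probability.RandomPlanarGeometry.SAW.HexBW`, all PROVED, standard axioms; `H ≥ 1`)

* **`log_slabConnectiveConstant_succ_sub_log_ge`** — `log(1 + μ(Slab_{H+1})^{-(2H+4)}) / (2(H+1)) ≤ log μ(Slab_{H+1}) − log μ(Slab_H)`;
* **`slabConnectiveConstant_lt_succ`** — `μ(Slab_H) < μ(Slab_{H+1})`; **`slabConnectiveConstant_lt_hex`** — `μ(Slab_H) < μ_ℍ`;
* **`summable_slabCount_mul_pow`** — `Summable (fun n => c_n(Slab_H) · x_c^n)` (SUB-CRITICALITY at `x_c`, every `H ≥ 1`),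
  from `c_n^{1/n} → μ(Slab_H) < 1/x_c`.
-/

noncomputable section

open Finset Filter Topology Literature.Probability.LatticeModels Literature.Probability.Percolation

namespace Literature.Probability.RandomPlanarGeometry.SAW.HexBW

section Door

/-- **Strict slab monotonicity WITH MARGIN**: for every `H ≥ 1`,
`log(1 + μ(Slab_{H+1})^{-(2H+4)}) / (2(H+1)) ≤ log μ(Slab_{H+1}) − log μ(Slab_H)`.
[cite: MadrasSlade1993, Theorem 8.2.1 (8.2.13) (p. 269; statement shape — ℤ^d tubes; lane construction for the brick wall)] -/
theorem log_slabConnectiveConstant_succ_sub_log_ge {H : ℕ} (hH : 1 ≤ H) :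
    Real.log (1 + slabConnectiveConstant (H + 1) ^ (-(2 * (H : ℝ) + 4))) / (2 * ((H : ℝ) + 1)) ≤
      Real.log (slabConnectiveConstant (H + 1)) - Real.log (slabConnectiveConstant H) :=
  log_slabConnectiveConstant_succ_sub_log_ge_of_insertion (Ψ := slabInsertion H) (cost := slabInsertionCost H) hH
    (fun n p hp c hc => slabInsertionCost_le n p hp c hc) (fun n p R hp hR => slabInsertion_mem n p R hp hR)
    (slabInsertion_injOn_insDom H)

/-- **`μ(Slab_H) < μ(Slab_{H+1})`** for the column slabs of the honeycomb lattice, `H ≥ 1` (Beaton's "`μ_T(1,y) < μ_{T+1}(1,y)`" at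
`y = 1`, up to the index shift). [cite: Beaton2014RotatedHoneycomb, §3.2, Propositions 8–9 at y = 1 (arXiv:1210.0274v3 p. 15; proof of Prop. 9 by reference to BBdGDCG14 Prop. 7 — not the proof formalised)]
[cite: MadrasSlade1993, Theorem 8.2.1 (8.2.13) (p. 269; ℤ^d tubes, proof by bridge renewal p. 270 — not the proof formalised)] -/
theorem slabConnectiveConstant_lt_succ {H : ℕ} (hH : 1 ≤ H) : slabConnectiveConstant H < slabConnectiveConstant (H + 1) :=
  slabConnectiveConstant_lt_succ_of_insertion (Ψ := slabInsertion H) (cost := slabInsertionCost H) hH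
    (fun n p hp c hc => slabInsertionCost_le n p hp c hc) (fun n p R hp hR => slabInsertion_mem n p R hp hR)
    (slabInsertion_injOn_insDom H)

/-- **`μ(Slab_H) < μ_ℍ`** for every `H ≥ 1`. [cite: Beaton2014RotatedHoneycomb, §3.2, Corollary 10 at y = 1 (arXiv:1210.0274v3 p. 15: ρ_T(1) = 1/μ_{T−1}(1,1) decreases to x_c — not the proof formalised)]
[cite: MadrasSlade1993, Theorem 8.2.1 (8.2.11) (p. 269; there via the Pattern Theorem — not the proof formalised)] -/
theorem slabConnectiveConstant_lt_hex {H : ℕ} (hH : 1 ≤ H) : slabConnectiveConstant H < hexConnectiveConstant :=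
  lt_of_lt_of_le (slabConnectiveConstant_lt_succ hH) (slabConnectiveConstant_le (by omega))

/-- **SUB-CRITICALITY of the column slabs at `x_c`**: `Σ_n c_n(Slab_H) x_c^n` converges for every `H ≥ 1`, because
`c_n(Slab_H)^{1/n} → μ(Slab_H) < μ_ℍ = 1/x_c` (the input Beaton uses in the proof of Corollary 13, p. 17: "`Ĉ_T(x_c,y)` is convergent
for `0 ≤ y < y†`" — here at `y = 1`). [cite: Beaton2014RotatedHoneycomb, §3.2, Corollary 10 at y = 1 (arXiv:1210.0274v3 p. 15) — mechanism here: the lane double-row insertion]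
[cite: MadrasSlade1993, Theorem 8.2.1 (8.2.11) (p. 269; ℤ^d, Pattern Theorem — not the proof formalised)] -/
theorem summable_slabCount_mul_pow {H : ℕ} (hH : 1 ≤ H) :
    Summable (fun n : ℕ => (slabCount H n : ℝ) * hexCriticalFugacity ^ n) := by
  have hx := hexCriticalFugacity_pos_lt_one.1
  set μ := slabConnectiveConstant H with hμ
  have hlt : μ < hexCriticalFugacity⁻¹ := by
    rw [← hexConnectiveConstant_eq_inv]
    exact slabConnectiveConstant_lt_hex hH
  have hμ0 : 0 < μ := slabConnectiveConstant_pos hH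
  set ρ := (μ + hexCriticalFugacity⁻¹) / 2 with hρ
  have hμρ : μ < ρ := by rw [hρ]; linarith
  have hρx : ρ * hexCriticalFugacity < 1 := by
    have : ρ < hexCriticalFugacity⁻¹ := by rw [hρ]; linarith
    calc ρ * hexCriticalFugacity < hexCriticalFugacity⁻¹ * hexCriticalFugacity :=
          mul_lt_mul_of_pos_right this hx
      _ = 1 := inv_mul_cancel₀ hx.ne'
  have hρ0 : 0 < ρ := by linarith
  have hev : ∀ᶠ m : ℕ in atTop, (slabCount H m : ℝ) * hexCriticalFugacity ^ m ≤ (ρ * hexCriticalFugacity) ^ m := by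
    have h1 := (tendsto_slabCount_rpow hH).eventually (gt_mem_nhds hμρ)
    filter_upwards [h1, eventually_ge_atTop 1] with m hm hm1
    have hc0 : (0 : ℝ) ≤ slabCount H m := Nat.cast_nonneg _
    have hpow : (slabCount H m : ℝ) ≤ ρ ^ m := by
      have h2 : ((slabCount H m : ℝ) ^ (1 / (m : ℝ))) ^ (m : ℝ) ≤ ρ ^ (m : ℝ) :=
        Real.rpow_le_rpow (Real.rpow_nonneg hc0 _) hm.le (Nat.cast_nonneg m)
      rw [← Real.rpow_mul hc0, one_div_mul_cancel (by positivity), Real.rpow_one, Real.rpow_natCast] at h2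
      exact h2
    rw [mul_pow]
    exact mul_le_mul_of_nonneg_right hpow (pow_nonneg hx.le m)
  refine Summable.of_norm_bounded_eventually_nat (summable_geometric_of_lt_one (by positivity) hρx) ?_
  filter_upwards [hev] with m hm
  rw [Real.norm_of_nonneg (by positivity)]
  exact hm

end Door

end Literature.Probability.RandomPlanarGeometry.SAW.HexBW
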